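import Summits.FinalStateConjecture.FinalStateConjecture.Theorems.ClusterCompletenessOmegaLimitMultiKerrVacuumLimit
import Summits.FinalStateConjecture.FinalStateConjecture.Theorems.ClusterCompletenessOmegaLimitMultiKerrOmegaLimitGlue
import Summits.FinalStateConjecture.FinalStateConjecture.Theorems.ClusterCompletenessOmegaLimitMultiKerrBackgroundOmegaLimits
import Literature.Geometry.Lorentzian.BilinPullbackEstimates
import Literature.Geometry.Lorentzian.KerrConvergence
import HarnessLib

/-!
# Route ClusterCompleteness · crux `OmegaLimitMultiKerr` — ω-limits inherit derivative bounds
# ("tame charts have tame ω-limits")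

Structure lemma for the crux stmt-FinalStateConjecture-14664 (`ClusterCompleteness.OmegaLimitMultiKerr`,
rank 9), line `Sketch`, lead gen 3, registered stub
`norm_iteratedFDeriv_omegaLimit_le_of_tendsto_supCkENorm` (closed form).

The ω-limit theorems of this line (`exists_omegaLimit_translate_of_bounded_truncLateRegion`,
`exists_omegaLimit_hole_translate`, …) produce, from a TAME late chart — a field `h` whose
derivatives are bounded on every truncated late region `{t > τ₀, r ≤ R}` of a background with a time
translation `e` — a `Cᵏ` field `g` with `supCkENorm K k (h (· + Tₙ • e) − g) → 0` on compact `K`.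
The rigidity inputs that IDENTIFY such limits (stationary asymptotically flat vacuum ⇒ Kerr) are
stated for metrics WITH BOUNDS; this file certifies, order by order, that every ω-limit inherits the
era's `Cⁱ` bounds (Hale 1980, Ch. I, §8: ω-limit sets are closed and inherit closed constraints —
here the closed constraint is the closed ball `‖Dⁱ·(x)‖ ≤ C`, and `Dⁱ` at a point of `K` is
continuous for `supCkENorm K k`-convergence, `i ≤ k`, by `tendsto_iteratedFDeriv_of_tendsto_supCkENorm_sub`):

* `norm_iteratedFDeriv_le_of_tendsto_supCkENorm_sub` — any filter, any family `fᵢ → g`: an eventual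
  bound `‖Dᵐ fᵢ (x)‖ ≤ C` passes to `‖Dᵐ g (x)‖ ≤ C` (`m ≤ k`, `x ∈ K`, `fᵢ`, `g` of class `Cᵐ` at `x`);
* `norm_iteratedFDeriv_omegaLimit_le` — the same for translates `y ↦ h (y + Tₙ • e)`, with the bound
  read on `h` itself at the translated points (`iteratedFDeriv_comp_add_right`);
* `norm_iteratedFDeriv_omegaLimit_le_of_tendsto_supCkENorm` (registered stub) — the set form over
  `K ⊆ O`, `O` open, `h`, `g` of class `Cᵏ` on `O`, translates of `K` eventually inside `O`;
* `supCkENorm_omegaLimit_le_of_tendsto_supCkENorm` — the `supCkENorm` reading: the closed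
  `supCkENorm K k`-ball of any radius `c ∈ [0, ∞]` is closed under ω-limits;
* `norm_iteratedFDeriv_omegaLimit_le_of_forall_mem_truncLateRegion`,
  `norm_iteratedFDeriv_omegaLimit_le_of_bounded_truncLateRegion`,
  `supCkENorm_omegaLimit_le_supCkENorm_truncLateRegion` — **tame charts have tame ω-limits**, in the
  setting of `exists_omegaLimit_translate_of_bounded_truncLateRegion` (domain `e`-invariant, time
  shifted, radius preserved): an all-time bound `‖Dⁱ h‖ ≤ C` on the truncated late region
  `{t > τ₀, r ≤ R}` gives `‖Dⁱ g (x)‖ ≤ C` at EVERY point `x` of the domain with `r(x) ≤ R` (any chart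
  time: the translates `x + Tₙ • e` of `x` are eventually late and have the same radius), and the
  `Cᵏ` size of `g` on the whole tube `{r ≤ R}` is at most the `Cᵏ` size of `h` on `{t > τ₀, r ≤ R}`
  for every `τ₀`.

Everything is proved; Mathlib + the landed `Literature` / `Theorems` files only.

## References
* J. K. Hale, *Ordinary differential equations*, 2nd ed., Krieger 1980, Ch. I, §8. [Hale1980]
* P. Petersen, *Riemannian Geometry*, 2nd ed., GTM 171, Springer 2006, Ch. 10, §3. [Petersen2006]
-/

-- every `Summit.FinalStateConjecture.FinalStateConjecture.…` name repeats the summit = sub-problem segment (D-0017 layout)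
set_option linter.dupNamespace false

noncomputable section

open scoped Manifold ContDiff Topology ENNReal
open Set Filter TopologicalSpace

namespace Summit.FinalStateConjecture.FinalStateConjecture.Theorems.ClusterCompleteness

open Literature.Geometry.Lorentzian

/-! ### Derivative bounds pass to `supCkENorm`-limits at a point -/

section Pointwise

variable {ι : Type*} {l : Filter ι} {F W : Type*} [NormedAddCommGroup F] [NormedSpace ℝ F]
  [NormedAddCommGroup W] [NormedSpace ℝ W]

/-- **Derivative bounds pass to `supCkENorm`-limits.** If `supCkENorm K k (fᵢ − g) → 0` along a
nontrivial filter, `fᵢ` (eventually) and `g` are `Cᵐ` at the point `x ∈ K`, `m ≤ k`, and eventually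
`‖Dᵐ fᵢ (x)‖ ≤ C`, then `‖Dᵐ g (x)‖ ≤ C`: the jets converge at `x`
(`tendsto_iteratedFDeriv_of_tendsto_supCkENorm_sub`) and the closed ball is closed (Hale 1980,
Ch. I, §8: limit sets inherit closed constraints). [cite: Hale1980, Ch. I §8] -/
theorem norm_iteratedFDeriv_le_of_tendsto_supCkENorm_sub [l.NeBot] {f : ι → F → W} {g : F → W}
    {K : Set F} {k m : ℕ} (hm : m ≤ k) {x : F} (hx : x ∈ K)
    (hf : ∀ᶠ i in l, ContDiffAt ℝ m (f i) x) (hg : ContDiffAt ℝ m g x)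
    (h : Tendsto (fun i ↦ supCkENorm K k (fun y ↦ f i y - g y)) l (𝓝 0)) {C : ℝ}
    (hb : ∀ᶠ i in l, ‖iteratedFDeriv ℝ m (f i) x‖ ≤ C) : ‖iteratedFDeriv ℝ m g x‖ ≤ C :=
  le_of_tendsto (tendsto_iteratedFDeriv_of_tendsto_supCkENorm_sub hm hx hf hg h).norm hb

/-- **ω-limits inherit derivative bounds (pointwise form).** If the translates `y ↦ h (y + Tₙ • e)`
converge to `g` in the sense `supCkENorm K k (h (· + Tₙ • e) − g) → 0`, `x ∈ K`, `i ≤ k`, `h` is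
eventually `Cⁱ` at the translated points `x + Tₙ • e` and `g` is `Cⁱ` at `x`, then an eventual bound
`‖Dⁱ h (x + Tₙ • e)‖ ≤ C` passes to the limit: `‖Dⁱ g (x)‖ ≤ C`
(`Dⁱ (h (· + a)) (x) = Dⁱ h (x + a)`, `iteratedFDeriv_comp_add_right`; Hale 1980, Ch. I, §8).
[cite: Hale1980, Ch. I §8] -/
theorem norm_iteratedFDeriv_omegaLimit_le {K : Set F} {k i : ℕ} {h g : F → W} {e : F} {T : ℕ → ℝ}
    {x : F} {C : ℝ} (hi : i ≤ k) (hx : x ∈ K) (hh : ∀ᶠ n in atTop, ContDiffAt ℝ i h (x + T n • e))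
    (hg : ContDiffAt ℝ i g x)
    (hlim : Tendsto (fun n ↦ supCkENorm K k (fun y ↦ h (y + T n • e) - g y)) atTop (𝓝 0))
    (hb : ∀ᶠ n in atTop, ‖iteratedFDeriv ℝ i h (x + T n • e)‖ ≤ C) :
    ‖iteratedFDeriv ℝ i g x‖ ≤ C := by
  refine norm_iteratedFDeriv_le_of_tendsto_supCkENorm_sub (f := fun n y ↦ h (y + T n • e)) hi hx
    (hh.mono fun n hn ↦ hn.comp x (contDiffAt_id.add contDiffAt_const)) hg hlim
    (hb.mono fun n hn ↦ ?_)
  rw [iteratedFDeriv_comp_add_right]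
  exact hn

end Pointwise

/-! ### The registered stub: set form over `K ⊆ O` -/

/-- **ω-limits inherit derivative bounds** (registered structure stub
`norm_iteratedFDeriv_omegaLimit_le_of_tendsto_supCkENorm` of the crux item, closed form; "limits of
tame charts are tame"). Let `O` be open, `h`, `g : E → W` of class `Cᵏ` on `O`, `K ⊆ O`, and let the
translates `K + Tₙ • e` lie in `O` for all large `n`. If the translates `y ↦ h (y + Tₙ • e)` converge
to `g` in the sense `supCkENorm K k (h (· + Tₙ • e) − g) → 0` and, for some `i ≤ k`, eventually
`‖Dⁱ h (x + Tₙ • e)‖ ≤ C` for all `x ∈ K`, then `‖Dⁱ g (x)‖ ≤ C` on `K` (Hale 1980, Ch. I, §8: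
ω-limit sets inherit closed constraints; the `i`-jet at a point of `K` is continuous for
`supCkENorm K k`-convergence). [cite: Hale1980, Ch. I §8] -/
theorem norm_iteratedFDeriv_omegaLimit_le_of_tendsto_supCkENorm :
    ∀ {E : Type*} [NormedAddCommGroup E] [NormedSpace ℝ E]
      {W : Type*} [NormedAddCommGroup W] [NormedSpace ℝ W]
      {O K : Set E} {k i : ℕ} {h g : E → W} {e : E} {T : ℕ → ℝ} {C : ℝ},
      IsOpen O → ContDiffOn ℝ k h O → ContDiffOn ℝ k g O → K ⊆ O →
      (∀ᶠ n in atTop, ∀ x ∈ K, x + T n • e ∈ O) →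
      Tendsto (fun n ↦ supCkENorm K k (fun y ↦ h (y + T n • e) - g y)) atTop (𝓝 0) →
      i ≤ k → (∀ᶠ n in atTop, ∀ x ∈ K, ‖iteratedFDeriv ℝ i h (x + T n • e)‖ ≤ C) →
      ∀ x ∈ K, ‖iteratedFDeriv ℝ i g x‖ ≤ C := by
  intro E _ _ W _ _ O K k i h g e T C hO hh hg hKO hKT hlim hi hb x hx
  have hik : (i : WithTop ℕ∞) ≤ k := by exact_mod_cast hi
  have hgx : ContDiffAt ℝ i g x := (hg.of_le hik).contDiffAt (hO.mem_nhds (hKO hx))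
  have hhx : ∀ᶠ n in atTop, ContDiffAt ℝ i h (x + T n • e) :=
    hKT.mono fun n hn ↦ (hh.of_le hik).contDiffAt (hO.mem_nhds (hn x hx))
  exact norm_iteratedFDeriv_omegaLimit_le hi hx hhx hgx hlim (hb.mono fun n hn ↦ hn x hx)

/-- **The `supCkENorm` reading: closed `Cᵏ` balls are closed under ω-limits.** In the setting of
`norm_iteratedFDeriv_omegaLimit_le_of_tendsto_supCkENorm`, if eventually
`supCkENorm K k (h (· + Tₙ • e)) ≤ c` (`c ∈ [0, ∞]`), then `supCkENorm K k g ≤ c`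
(`supCkENorm_le_ofReal` with the pointwise bounds `norm_iteratedFDeriv_le_toReal_supCkENorm`;
Hale 1980, Ch. I, §8). [cite: Hale1980, Ch. I §8] -/
theorem supCkENorm_omegaLimit_le_of_tendsto_supCkENorm :
    ∀ {E : Type*} [NormedAddCommGroup E] [NormedSpace ℝ E]
      {W : Type*} [NormedAddCommGroup W] [NormedSpace ℝ W]
      {O K : Set E} {k : ℕ} {h g : E → W} {e : E} {T : ℕ → ℝ} {c : ℝ≥0∞},
      IsOpen O → ContDiffOn ℝ k h O → ContDiffOn ℝ k g O → K ⊆ O →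
      (∀ᶠ n in atTop, ∀ x ∈ K, x + T n • e ∈ O) →
      Tendsto (fun n ↦ supCkENorm K k (fun y ↦ h (y + T n • e) - g y)) atTop (𝓝 0) →
      (∀ᶠ n in atTop, supCkENorm K k (fun y ↦ h (y + T n • e)) ≤ c) →
      supCkENorm K k g ≤ c := by
  intro E _ _ W _ _ O K k h g e T c hO hh hg hKO hKT hlim hb
  rcases eq_or_ne c ⊤ with rfl | hc
  · exact le_top
  rw [← ENNReal.ofReal_toReal hc]
  refine supCkENorm_le_ofReal fun m hm x hx ↦ ?_
  refine norm_iteratedFDeriv_omegaLimit_le_of_tendsto_supCkENorm hO hh hg hKO hKT hlim hm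
    (hb.mono fun n hn y hy ↦ ?_) x hx
  have h1 := norm_iteratedFDeriv_le_toReal_supCkENorm hm hy (fun z ↦ h (z + T n • e))
    (ne_top_of_le_ne_top hc hn)
  rw [iteratedFDeriv_comp_add_right] at h1
  exact h1.trans (ENNReal.toReal_mono hc hn)

/-! ### Tame charts have tame ω-limits (background setting) -/

/-- **Tame charts have tame ω-limits, pointwise.** In the setting of
`exists_omegaLimit_translate_of_bounded_truncLateRegion` — the domain of the background `B` is
invariant under `x ↦ x + s • e`, the time function is shifted by `s` and the radius function is
preserved — let `h`, `g` be `Cᵏ` on the domain and let the translates `h (· + Tₙ • e)`, `Tₙ → +∞`,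
converge to `g` in `Cᵏ` on every compact subset of the domain. If `‖Dⁱ h‖ ≤ C` on the truncated
late region `{t > τ₀, r ≤ R}` (`i ≤ k`), then `‖Dⁱ g (x)‖ ≤ C` at EVERY point `x` of the domain with
`r(x) ≤ R`, whatever its chart time: the translates `x + Tₙ • e` have radius `r(x)` and time
`t(x) + Tₙ > τ₀` for large `n` (Hale 1980, Ch. I, §8). [cite: Hale1980, Ch. I §8] -/
theorem norm_iteratedFDeriv_omegaLimit_le_of_forall_mem_truncLateRegion :
    ∀ {W : Type*} [NormedAddCommGroup W] [NormedSpace ℝ W] (B : ModelBackground) (e : E4),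
      (∀ x ∈ (B.domain : Set E4), ∀ s : ℝ, x + s • e ∈ (B.domain : Set E4)) →
      (∀ (x : E4) (s : ℝ), B.time (x + s • e) = B.time x + s) →
      (∀ (x : E4) (s : ℝ), B.radius (x + s • e) = B.radius x) →
      ∀ {k : ℕ} {h : E4 → W}, ContDiffOn ℝ k h (B.domain : Set E4) →
      ∀ {g : E4 → W}, ContDiffOn ℝ k g (B.domain : Set E4) →
      ∀ {T : ℕ → ℝ}, Tendsto T atTop atTop →
      (∀ K ⊆ (B.domain : Set E4), IsCompact K →
        Tendsto (fun n ↦ supCkENorm K k (fun x ↦ h (x + T n • e) - g x)) atTop (𝓝 0)) →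
      ∀ {i : ℕ} {τ₀ R C : ℝ}, i ≤ k →
      (∀ y ∈ Subtype.val '' B.truncLateRegion τ₀ R, ‖iteratedFDeriv ℝ i h y‖ ≤ C) →
      ∀ x ∈ (B.domain : Set E4), B.radius x ≤ R → ‖iteratedFDeriv ℝ i g x‖ ≤ C := by
  intro W _ _ B e hdom htime hrad k h hh g hg T hT hlim i τ₀ R C hi hb x hxO hxR
  have hO : IsOpen (B.domain : Set E4) := B.domain.isOpen
  have hxK : ({x} : Set E4) ⊆ (B.domain : Set E4) := singleton_subset_iff.2 hxO
  refine norm_iteratedFDeriv_omegaLimit_le_of_tendsto_supCkENorm (K := {x}) hO hh hg hxK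
    (Eventually.of_forall fun n y hy ↦ ?_) (hlim {x} hxK isCompact_singleton) hi ?_ x
    (mem_singleton x)
  · rw [mem_singleton_iff.1 hy]
    exact hdom x hxO _
  · filter_upwards [hT.eventually_gt_atTop (τ₀ - B.time x)] with n hn y hy
    rw [mem_singleton_iff.1 hy]
    refine hb _ ⟨⟨x + T n • e, hdom x hxO _⟩, ⟨?_, ?_⟩, rfl⟩
    · show τ₀ < B.time (x + T n • e)
      rw [htime]
      linarith
    · show B.radius (x + T n • e) ≤ R
      rwa [hrad]

/-- **Tame charts have tame ω-limits** (drop-in form for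
`exists_omegaLimit_translate_of_bounded_truncLateRegion`, whose field `h` is `C^{k+1}` with bounds
on all derivatives of order `≤ k + 1` over each truncated late region). If `‖Dⁱ h‖ ≤ C` on
`{t > τ₀, r ≤ R}` for all `i ≤ k + 1`, then every `Cᵏ` ω-limit `g` of the translates along `Tₙ → +∞`
satisfies `‖Dⁱ g (x)‖ ≤ C` for all `i ≤ k` and all `x` in the domain with `r(x) ≤ R` — the SAME
constant, at ALL chart times (Hale 1980, Ch. I, §8). [cite: Hale1980, Ch. I §8] -/
theorem norm_iteratedFDeriv_omegaLimit_le_of_bounded_truncLateRegion :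
    ∀ {W : Type*} [NormedAddCommGroup W] [NormedSpace ℝ W] (B : ModelBackground) (e : E4),
      (∀ x ∈ (B.domain : Set E4), ∀ s : ℝ, x + s • e ∈ (B.domain : Set E4)) →
      (∀ (x : E4) (s : ℝ), B.time (x + s • e) = B.time x + s) →
      (∀ (x : E4) (s : ℝ), B.radius (x + s • e) = B.radius x) →
      ∀ {k : ℕ} {h : E4 → W}, ContDiffOn ℝ (k + 1) h (B.domain : Set E4) →
      ∀ {g : E4 → W}, ContDiffOn ℝ k g (B.domain : Set E4) →
      ∀ {T : ℕ → ℝ}, Tendsto T atTop atTop →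
      (∀ K ⊆ (B.domain : Set E4), IsCompact K →
        Tendsto (fun n ↦ supCkENorm K k (fun x ↦ h (x + T n • e) - g x)) atTop (𝓝 0)) →
      ∀ {τ₀ R C : ℝ}, (∀ i, i ≤ k + 1 →
        ∀ y ∈ Subtype.val '' B.truncLateRegion τ₀ R, ‖iteratedFDeriv ℝ i h y‖ ≤ C) →
      ∀ i, i ≤ k → ∀ x ∈ (B.domain : Set E4), B.radius x ≤ R → ‖iteratedFDeriv ℝ i g x‖ ≤ C := by
  intro W _ _ B e hdom htime hrad k h hh g hg T hT hlim τ₀ R C hb i hi x hxO hxR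
  have hk : ((k : ℕ) : WithTop ℕ∞) ≤ ((k + 1 : ℕ) : WithTop ℕ∞) := by
    exact_mod_cast (Nat.le_succ k)
  exact norm_iteratedFDeriv_omegaLimit_le_of_forall_mem_truncLateRegion B e hdom htime hrad
    (hh.of_le hk) hg hT hlim hi (hb i (Nat.le_succ_of_le hi)) x hxO hxR

/-- **Tame charts have tame ω-limits, `supCkENorm` form.** In the same setting (`h`, `g` of class
`Cᵏ` on the domain, `supCkENorm K k (h (· + Tₙ • e) − g) → 0` on compacts, `Tₙ → +∞`), for every
`τ₀` and `R` the `Cᵏ` size of the ω-limit `g` on the WHOLE tube `{x ∈ domain | r(x) ≤ R}` is at most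
the `Cᵏ` size of `h` on the truncated late region `{t > τ₀, r ≤ R}`: the ω-limit only sees the
asymptotic `Cᵏ` size of the era chart (Hale 1980, Ch. I, §8). [cite: Hale1980, Ch. I §8] -/
theorem supCkENorm_omegaLimit_le_supCkENorm_truncLateRegion :
    ∀ {W : Type*} [NormedAddCommGroup W] [NormedSpace ℝ W] (B : ModelBackground) (e : E4),
      (∀ x ∈ (B.domain : Set E4), ∀ s : ℝ, x + s • e ∈ (B.domain : Set E4)) →
      (∀ (x : E4) (s : ℝ), B.time (x + s • e) = B.time x + s) →
      (∀ (x : E4) (s : ℝ), B.radius (x + s • e) = B.radius x) →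
      ∀ {k : ℕ} {h : E4 → W}, ContDiffOn ℝ k h (B.domain : Set E4) →
      ∀ {g : E4 → W}, ContDiffOn ℝ k g (B.domain : Set E4) →
      ∀ {T : ℕ → ℝ}, Tendsto T atTop atTop →
      (∀ K ⊆ (B.domain : Set E4), IsCompact K →
        Tendsto (fun n ↦ supCkENorm K k (fun x ↦ h (x + T n • e) - g x)) atTop (𝓝 0)) →
      ∀ (τ₀ R : ℝ), supCkENorm {x | x ∈ (B.domain : Set E4) ∧ B.radius x ≤ R} k g ≤
        supCkENorm (Subtype.val '' B.truncLateRegion τ₀ R) k h := by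
  intro W _ _ B e hdom htime hrad k h hh g hg T hT hlim τ₀ R
  rcases eq_or_ne (supCkENorm (Subtype.val '' B.truncLateRegion τ₀ R) k h) ⊤ with htop | hfin
  · rw [htop]
    exact le_top
  rw [← ENNReal.ofReal_toReal hfin]
  refine supCkENorm_le_ofReal fun m hm x hx ↦ ?_
  exact norm_iteratedFDeriv_omegaLimit_le_of_forall_mem_truncLateRegion B e hdom htime hrad hh hg
    hT hlim hm (fun y hy ↦ norm_iteratedFDeriv_le_toReal_supCkENorm hm hy h hfin) x hx.1 hx.2

/-- **Letting `τ₀ → ∞`**: the `Cᵏ` size of the ω-limit on the tube `{r ≤ R}` is bounded by the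
infimum over `τ₀` of the `Cᵏ` sizes of `h` on `{t > τ₀, r ≤ R}` (its `limsup` in time), in the
setting of `supCkENorm_omegaLimit_le_supCkENorm_truncLateRegion` (Hale 1980, Ch. I, §8).
[cite: Hale1980, Ch. I §8] -/
theorem supCkENorm_omegaLimit_le_iInf_supCkENorm_truncLateRegion :
    ∀ {W : Type*} [NormedAddCommGroup W] [NormedSpace ℝ W] (B : ModelBackground) (e : E4),
      (∀ x ∈ (B.domain : Set E4), ∀ s : ℝ, x + s • e ∈ (B.domain : Set E4)) →
      (∀ (x : E4) (s : ℝ), B.time (x + s • e) = B.time x + s) →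
      (∀ (x : E4) (s : ℝ), B.radius (x + s • e) = B.radius x) →
      ∀ {k : ℕ} {h : E4 → W}, ContDiffOn ℝ k h (B.domain : Set E4) →
      ∀ {g : E4 → W}, ContDiffOn ℝ k g (B.domain : Set E4) →
      ∀ {T : ℕ → ℝ}, Tendsto T atTop atTop →
      (∀ K ⊆ (B.domain : Set E4), IsCompact K →
        Tendsto (fun n ↦ supCkENorm K k (fun x ↦ h (x + T n • e) - g x)) atTop (𝓝 0)) →
      ∀ R : ℝ, supCkENorm {x | x ∈ (B.domain : Set E4) ∧ B.radius x ≤ R} k g ≤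
        ⨅ τ₀ : ℝ, supCkENorm (Subtype.val '' B.truncLateRegion τ₀ R) k h := by
  intro W _ _ B e hdom htime hrad k h hh g hg T hT hlim R
  exact le_iInf fun τ₀ ↦
    supCkENorm_omegaLimit_le_supCkENorm_truncLateRegion B e hdom htime hrad hh hg hT hlim τ₀ R

end Summit.FinalStateConjecture.FinalStateConjecture.Theorems.ClusterCompleteness

end
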